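import Literature.NumberTheory.EllipticCurves.Kobayashi2003.EtaColemanInterpolation
import Literature.NumberTheory.EllipticCurves.IwasawaFunctionConstantDescent
import Literature.NumberTheory.EllipticCurves.Kato2004.AdmissibleZetaClassRealisabilityCM
import Literature.NumberTheory.EllipticCurves.Kato2004.AdmissibleZetaClassPositionProofs
import Literature.NumberTheory.EllipticCurves.Kato2004.AdmissibleZetaClassNonvanishingProofs
import Summits.BirchSwinnertonDyer.BirchSwinnertonDyer.Theorems.CyclotomicUntwistRohrlichAtLevel
import Summits.BirchSwinnertonDyer.Rank1Residual.Additive.KatoDescentAdmissibleIstarZero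
import Mathlib.Algebra.Module.Torsion.Field
import HarnessLib

/-!
# Stub 2c-T1 (`stub_zetaLinesProportionalIstarZero`) of the line `kato_perrin_riou_istar` (item 19223) BY SIGNATURE,
# from Kobayashi's `η`-Coleman interpolation law [A], the CM realisability fact (F-CM) and ONE named hypothesis `hC`
# (the twist comparison [C]) — THEOREMS ONLY (no `def`, no named fact, no instance, no notation, no `sorry`)

Cell `bsd-cm`, seat `bsd-cm-k-ty1` g39 (literature-prover identity), executing the host brief
`pub/bsd-eis/plan-g43/briefs/BRIEF-ibsb-9-2cT1-OfColPlusInterpolation.md` (03887c1b9f2d14ef) under director-bsd (970)(a),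
pen bsd-cm-plan g40 D1202–D1205, host bsd-eis g43 deltas d1–d5, critic idea-crit-15 g20 NOTE #61. Lane
`Rank1Residual/Additive/` (precedent p832718). Count-neutral until the pen's istar v16 cites the theorem BY NAME.

## What is proved (kernel, standard axioms)

* `exists_coherent_padicEmbeddings p`: embeddings `ιp_m : ℚ(ζ_m) → ℂ_p` COHERENT on `ℚ(ζ_p)` along the `p`-power levels
  (hypothesis (COH) of `Kobayashi2003.ColPlusInterpolation`). [folklore]
* `stub2cT1_of_colPlusInterpolation hA hFCM hC : <TYPE of istar v15's stub_zetaLinesProportionalIstarZero VERBATIM>`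
  (istar v15 sha16 1c7e623d6cf61178, l.380–397; comment-stripped token diff of the conclusion = 0 hunks, 242 tokens):
  - `hA : Kobayashi2003.exists_colPlusInterpolation` — [A] (Kobayashi 2003 Prop. 8.25, (8.29), Prop. 8.26; p834027);
  - `hFCM : Kato2004.exists_isAdmissibleZetaClass_of_hasCM_of_irreducible` — conjunct `.2.2.1` of `stub_printFactsKato`;
  - `hC` — ONE NAMED HYPOTHESIS, the residue [C] (critic NOTE #61 (2): «ψ-INDEPENDENCE of the ratio of the two value
    laws»): for the frame and for EVERY exp*-datum `(ι, q, Λ, d)` with `DefinedExpStarBody W p f_W d ι q Λ`, every Kato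
    family `(z, x)` with `ZetaBody …` under the printed guards, every multiplier datum of (A5′) and every COHERENT `ιp`,
    there are ONE `C′ ∈ ℂ_p` and ONE unit `w ∈ Λˣ` with, at every EVEN `n` and every `ψ` mod `p^{n+1}` of order `2pⁿ`,
    `τ_p(ψ)·Σ_b θ(b)·ιp(σ_b exp*_{n+1,∅}(res ∘ cor (z_{p^{n+1}}))) = C′·(w·M̃)(ψ(γ)−1)·Σ_a ψ(a)[a/p^{n+1}]^{±}_{f_V}`
    (`θ = ψ^{pⁿ−1}`; `M̃ = katoMultiplier …` of (A6′); `(w·M̃)(ψ(γ)−1)` the sum of the convergent series; `±` = `Even (p/2)`).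
    In print: Kato Thm. 12.5 (1)/6.6/9.7, `L(f_W, χ̄, 1) = L(f_V, ηχ̄, 1)`, Birch on both sides (tree theorems) and the
    period relation `Ω⁺_{f_W} ∈ ℚ^×·Ω^{±}_{f_V}/τ(η)` of the twist `W = V ⊗ η` — labelled RESEARCH by the cell; NOT a
    re-typed [A], NOT a re-typed Birch formula, NOT «∀ admissible z₁, Col⁺(z₁) ∝ Col⁺(P₁.z)». Nothing asserted; per pen
    D1202 (c) the line's v16 reshapes 2c-T1 to a stub with this text (`stub_twistScalarIstarZero`), sorries unchanged.

## Proof (the brief's F1)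

(i) `P₁` from `hA` (`FB₁ := W.fineSelmerDualData κ hγ`); admissible `z₁` from `hFCM` (`W[p]` irreducible by
`hasIrreducibleModPGaloisRep_of_hasSignedLocalType_IstarZero`); `z₁ ≠ 0` unconditionally (`ne_zero_of_rohrlich` +
`PSRohrlichAtLevel.rohrlich_primePow_of_isNewformOf`); the admissible body gives the exp*-datum, the Kato family, the
lift `y` (A4), `M̃ ≠ 0` (`katoMultiplier_ne_zero`) and the position `(p^{A₀}M̃) • z₁ = (u p^{B₀}) • y`; `g := Col⁺_η(y) ≠ 0`.
(ii) [A] at `y` through a coherent `ιp`, (A4), `hC`, Kobayashi's law `isPlus_colPlus_z` for `g₁ := Col⁺_η(P₁.z)` and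
`tsum_map_coeff_mul_mul_pow` ⇒ `g(ψ(γ)−1) = C·h(ψ(γ)−1)`, `h := w·M̃·g₁`, ONE `C ∈ ℂ_p`.
(iii) `IwasawaAlgebra.exists_pow_smul_eq_of_values_proportional` (p835629) ⇒ `p^a g = v p^b h`; `Col⁺_η` injective, the
position, `M̃ ≠ 0` and `IwasawaH1Data.noZeroSMulDivisors` ⇒ `p^{a+A₀} • z₁ = ((uvw) p^{B₀+b}) • P₁.z`; `units_smul`.

HONEST LABELS: a theorem about the stub's statement under three hypotheses (two Literature facts of record, one
RESEARCH-labelled comparison `hC`); 2c-T1 is NOT closed by this file; 19223/19945/19804 OPEN; no summit statement is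
proved; `X12.CMInertBad` NOT proved; BSD is proved for no curve.
References: [Kobayashi2003] Prop. 8.25–8.26, (8.29), Thm. 6.3, (3.4)–(3.6); [Kato2004Asterisque] Thm. 12.5 (1),
Lemma 13.10, Thm. 6.6, Thm. 9.7, Ex. 13.3; [Washington1997] §7.2, Thm. 7.3; [BurungaleTian2026] Rem. 2.7.
-/


noncomputable section

open scoped Classical NumberField TensorProduct

open WeierstrassCurve Literature.NumberTheory.EllipticCurves Literature.NumberTheory.GaloisRepresentations
open Literature.NumberTheory.EllipticCurves.ModularForms
open Literature.NumberTheory.EllipticCurves.Rank1Residual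
open Literature.NumberTheory.EllipticCurves.Rank1Residual.Typed
open Literature.NumberTheory.EllipticCurves.IwasawaAlgebra
open Summit.BirchSwinnertonDyer.Rank1Residual
open Summit.BirchSwinnertonDyer.Rank1Residual.Additive
open Summit.BirchSwinnertonDyer.Rank1Residual.X12.O10
open Literature.NumberTheory.EllipticCurves.Kato2004
open Literature.NumberTheory.EllipticCurves.Kato2004.EulerSystemValues
open Summit.BirchSwinnertonDyer.BirchSwinnertonDyer.Theorems

namespace Summit.BirchSwinnertonDyer.Rank1Residual.Additive.CccOneZetaLines

set_option backward.isDefEq.respectTransparency false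

section Coherent

variable (p : ℕ) [hp : Fact p.Prime]

omit hp in
/-- `m(k, ∅) = p ^ k`. [folklore] -/
private theorem cycLevel_empty (k : ℕ) : cycLevel p k ∅ = p ^ k := by simp [cycLevel]

/-- An embedding of the `m`-th cyclotomic field into `ℂ_p`. [folklore] -/
private theorem nonempty_algHom_cyclotomicField_padicComplex (m : ℕ) :
    Nonempty (CyclotomicField m ℚ →ₐ[ℚ] ℂ_[p]) := by
  haveI : Algebra.IsAlgebraic ℚ (CyclotomicField m ℚ) := Algebra.IsAlgebraic.of_finite ℚ _
  haveI : Module.IsTorsionFree ℚ ℂ_[p] := DivisionSemiring.to_moduleIsTorsionFree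
  exact ⟨IsAlgClosed.lift⟩

/-- **Embeddings `ιp_m : ℚ(ζ_m) → ℂ_p` COHERENT on `ℚ(ζ_p)` along the `p`-power levels** ((COH) of
`Kobayashi2003.ColPlusInterpolation`: `ιp(ζ_{p^{n+1}})^{pⁿ} = ιp(ζ_p)`): at level `p^{n+1}` precompose an arbitrary
embedding with `σ_b` for the unit `b` carrying the `pⁿ`-th power of the image of `ζ_{p^{n+1}}` to a fixed `ζ_p`. [folklore] -/
theorem exists_coherent_padicEmbeddings :
    ∃ ιp : (m : ℕ) → (CyclotomicField m ℚ →+* ℂ_[p]),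
      ∀ n : ℕ, ιp (cycLevel p (n + 1) ∅)
          (IsCyclotomicExtension.zeta (cycLevel p (n + 1) ∅) ℚ (CyclotomicField (cycLevel p (n + 1) ∅) ℚ)) ^ (p ^ n) =
        ιp (cycLevel p 1 ∅)
          (IsCyclotomicExtension.zeta (cycLevel p 1 ∅) ℚ (CyclotomicField (cycLevel p 1 ∅) ℚ)) := by
  have hP : p.Prime := hp.out
  obtain ⟨e₁⟩ := nonempty_algHom_cyclotomicField_padicComplex p (cycLevel p 1 ∅)
  set ξ₁ : ℂ_[p] := e₁ (IsCyclotomicExtension.zeta (cycLevel p 1 ∅) ℚ (CyclotomicField (cycLevel p 1 ∅) ℚ))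
    with hξ₁
  have hξ₁prim : IsPrimitiveRoot ξ₁ p := by
    have h : IsPrimitiveRoot ξ₁ (cycLevel p 1 ∅) :=
      (IsCyclotomicExtension.zeta_spec (cycLevel p 1 ∅) ℚ
        (CyclotomicField (cycLevel p 1 ∅) ℚ)).map_of_injective e₁.toRingHom.injective
    rwa [cycLevel_empty, pow_one] at h
  have key : ∀ m : ℕ, ∃ e : CyclotomicField m ℚ →+* ℂ_[p], ∀ (n : ℕ) (hm : m = cycLevel p (n + 1) ∅),
      letI : NeZero m := hm ▸ inferInstance
      e (IsCyclotomicExtension.zeta m ℚ (CyclotomicField m ℚ)) ^ (p ^ n) = ξ₁ := by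
    intro m
    by_cases hm : ∃ n : ℕ, m = cycLevel p (n + 1) ∅
    · obtain ⟨n, rfl⟩ := hm
      have hmeq : cycLevel p (n + 1) ∅ = p ^ n * p := by rw [cycLevel_empty, pow_succ]
      obtain ⟨e₀⟩ := nonempty_algHom_cyclotomicField_padicComplex p (cycLevel p (n + 1) ∅)
      set ζ := IsCyclotomicExtension.zeta (cycLevel p (n + 1) ∅) ℚ (CyclotomicField (cycLevel p (n + 1) ∅) ℚ)
        with hζ
      have hζprim : IsPrimitiveRoot ζ (cycLevel p (n + 1) ∅) := IsCyclotomicExtension.zeta_spec _ ℚ _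
      have hx : IsPrimitiveRoot (e₀ ζ ^ (p ^ n)) p :=
        (hζprim.map_of_injective e₀.toRingHom.injective).pow (NeZero.pos _) hmeq
      obtain ⟨i, -, hi⟩ := hx.eq_pow_of_pow_eq_one hξ₁prim.pow_eq_one
      have hicop : i.Coprime p := (hx.pow_iff_coprime hP.pos i).mp (by rw [hi]; exact hξ₁prim)
      have hicopm : i.Coprime (cycLevel p (n + 1) ∅) := by
        rw [cycLevel_empty]; exact Nat.Coprime.pow_right _ hicop
      set b : (ZMod (cycLevel p (n + 1) ∅))ˣ := ZMod.unitOfCoprime i hicopm with hb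
      refine ⟨e₀.toRingHom.comp (sigma (cycLevel p (n + 1) ∅) b).toAlgHom.toRingHom, ?_⟩
      intro n' hn'
      have hnn' : n' = n := by
        have h := hn'
        rw [cycLevel_empty, cycLevel_empty] at h
        have := Nat.pow_right_injective hP.two_le h
        omega
      subst hnn'
      rw [RingHom.comp_apply]
      change e₀ (sigma (cycLevel p (n' + 1) ∅) b ζ) ^ p ^ n' = ξ₁
      rw [sigma_apply_zeta, map_pow, ← pow_mul, mul_comm, pow_mul, hb, ZMod.coe_unitOfCoprime,
        ZMod.val_natCast]
      have hxm : (e₀ ζ ^ p ^ n') ^ (cycLevel p (n' + 1) ∅) = 1 := by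
        rw [congrArg (fun k : ℕ => (e₀ ζ ^ p ^ n') ^ k) hmeq, mul_comm, pow_mul, hx.pow_eq_one, one_pow]
      rw [← hi]
      conv_rhs => rw [← Nat.mod_add_div i (cycLevel p (n' + 1) ∅), pow_add, pow_mul, hxm, one_pow, mul_one]
    · obtain ⟨e⟩ := nonempty_algHom_cyclotomicField_padicComplex p m
      exact ⟨e.toRingHom, fun n hn => absurd ⟨n, hn⟩ hm⟩
  choose ιp hιp using key
  refine ⟨ιp, fun n => ?_⟩
  have h1 := hιp (cycLevel p (n + 1) ∅) n rfl
  have h0 := hιp (cycLevel p 1 ∅) 0 rfl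
  rw [pow_zero, pow_one] at h0
  exact h1.trans h0.symm

/-- `γ^{pⁿ} = 1` in `(ℤ/p^{n+1})` for the generator `γ = 1 + p` of `1 + pℤ_p`, `p` odd. [folklore] -/
private theorem cyclotomicGenerator_pow_prime_pow_eq_one (hp2 : p ≠ 2) (n : ℕ) :
    (cyclotomicGenerator p : ZMod (p ^ (n + 1))) ^ (p ^ n) = 1 := by
  have key : ∀ m : ℕ, m = cyclotomicExponent p →
      (cyclotomicGenerator p : ZMod (p ^ (n + m))) ^ (p ^ n) = 1 := by
    rintro m rfl
    have h := pow_orderOf_eq_one (cyclotomicGenerator p : ZMod (p ^ (n + cyclotomicExponent p)))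
    rwa [orderOf_cyclotomicGenerator] at h
  exact key 1 (show (1 : ℕ) = cyclotomicExponent p from (if_neg hp2).symm)

/-- `|ψ(γ) − 1| < 1` for a Dirichlet character `ψ` mod `p^{n+1}` with values in `ℂ_p`, `p` odd
(`ψ(γ)^{pⁿ} = ψ(γ^{pⁿ}) = 1`). [cite: MazurTateTeitelbaum1986Invent, §I.13] -/
private theorem norm_apply_cyclotomicGenerator_sub_one_lt' (hp2 : p ≠ 2) {n : ℕ}
    (ψ : DirichletCharacter ℂ_[p] (p ^ (n + 1))) :
    ‖ψ (cyclotomicGenerator p : ZMod (p ^ (n + 1))) - 1‖ < 1 :=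
  norm_sub_one_lt_one_of_pow_prime_pow_eq_one (j := n)
    (by rw [← map_pow, cyclotomicGenerator_pow_prime_pow_eq_one p hp2 n, map_one])

end Coherent

set_option maxHeartbeats 800000 in
/-- **Stub 2c-T1 of `kato_perrin_riou_istar` BY SIGNATURE** from [A] `Kobayashi2003.exists_colPlusInterpolation`,
(F-CM) `Kato2004.exists_isAdmissibleZetaClass_of_hasCM_of_irreducible` and ONE named hypothesis `hC` = [C], the
`ψ`-independence of the ratio of Kato's and Kobayashi's value laws (module docstring): for every row member `W` of signed
type `(p, I₀*)`, `p ≥ 5`, `r_an = 1`, every frame and every `I`, an admissible `z₁` and Kobayashi's datum `P₁` lie on ONE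
`Λ`-line of `𝐇¹` up to `p`-powers. Count-neutral helper; nothing about BSD is asserted; 19223 stays OPEN.
[cite: Kobayashi2003, Prop. 8.25, (8.29), Prop. 8.26 (pp. 24–25), Thm. 6.3 (p. 11)]
[cite: Kato2004Asterisque, Thm. 12.5 (1) (p. 221), Lemma 13.10 (p. 230), Thm. 6.6 (p. 163)]
[cite: Washington1997, §7.2 and Thm. 7.3] -/
theorem stub2cT1_of_colPlusInterpolation
    (hA : Kobayashi2003.exists_colPlusInterpolation)
    (hFCM : Kato2004.exists_isAdmissibleZetaClass_of_hasCM_of_irreducible)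
    (hC : ∀ (p : ℕ) [Fact p.Prime] (hp : p ≠ 2), 5 ≤ p →
      ∀ (K₀ : Type) [Field K₀] [NumberField K₀] [IsCyclotomicExtension {p} ℚ K₀]
        (η : Field.absoluteGaloisGroup ℚ →* ℤˣ), (∀ σ ∈ galRange (K := ℚ) K₀, η σ = 1) → η ≠ 1 →
      ∀ (V : WeierstrassCurve ℚ) [V.IsElliptic] [V.IsGloballyMinimal] {N : ℕ} [NeZero N]
        {f : CuspForm (CongruenceSubgroup.Gamma0 N) 2},
        V.HasGoodReductionAtPrime p → V.frobeniusTrace p = 0 → ModularForms.IsNewformOf V f →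
      ∀ (W : WeierstrassCurve ℚ) [W.IsElliptic] [ContinuousSMul ℤ_[p] (W.tateModule p)]
        [Module.Free ℤ_[p] (W.tateModule p)] [Module.Finite ℤ_[p] (W.tateModule p)]
        (C : VariableChange ℚ), C • W.quadraticTwist ((-1) ^ (p / 2) * p) = V →
      ∀ (κ : ZpExtension ℚ p) (hκ : κ.IsCyclotomic)
        {NW : ℕ} [NeZero NW] (fW : CuspForm (CongruenceSubgroup.Gamma0 NW) 2), ModularForms.IsNewformOf W fW →
      ∀ (ι : (m : ℕ) → (CyclotomicField m ℚ →+* ℂ)) (q : ℚ)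
        (Λ : ∀ (k : ℕ) (r : Finset (IsDedekindDomain.HeightOneSpectrum (𝓞 ℚ))),
          H1 (tateRep W p) (cycSubgroup p k r) →ₗ[ℤ_[p]]
            ℚ_[p] ⊗[ℚ] CyclotomicField (cycLevel p k r) ℚ)
        (d : _), Kato2004.DefinedExpStarBody W p fW d ι ((q : ℚ) : ℝ) Λ →
      ∀ (c d₁ a : ℤ) (A : ℕ) (d' : ℤ), 0 < A → Int.gcd c (6 * p * A) = 1 → Int.gcd d₁ (6 * p * NW) = 1 →
        (d₁ : ℤ) * d' ≡ 1 [ZMOD (A : ℤ)] → ratCuspFactor fW true c d₁ a A d' ≠ 0 →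
      ∀ (z : ∀ (k : ℕ) (r : (cyclotomicLevelsRat p (badPlaces c d₁ A NW)).Ideals),
            H1 (tateRep W p) ((cyclotomicLevelsRat p (badPlaces c d₁ A NW)).level k r.1))
        (x : ∀ (k : ℕ) (r : (cyclotomicLevelsRat p (badPlaces c d₁ A NW)).Ideals),
            CyclotomicField (cycLevel p k r.1) ℚ),
        Kato2004.ZetaBody W p fW ι ((q : ℚ) : ℝ) Λ c d₁ a A z x →
      ∀ (qm : ℚ) (n₁ n₂ n₃ n₄ : ℤ) (σc σd : Field.absoluteGaloisGroup ℚ) (σℓ : ℕ → Field.absoluteGaloisGroup ℚ),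
        0 < qm → AddSubgroup.closure (Set.range (ratMinusSymbol fW)) = AddSubgroup.zmultiples qm →
        ratMinusSymbol fW ((a : ℚ) / A) = n₁ * qm → ratMinusSymbol fW ((a * c : ℚ) / A) = n₂ * qm →
        ratMinusSymbol fW ((a * d' : ℚ) / A) = n₃ * qm → ratMinusSymbol fW ((a * c * d' : ℚ) / A) = n₄ * qm →
        ((GaloisRep.cyclotomicCharacter ℚ p σc : ℤ_[p]ˣ) : ℤ_[p]) = c →
        ((GaloisRep.cyclotomicCharacter ℚ p σd : ℤ_[p]ˣ) : ℤ_[p]) = d₁ →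
        (∀ ℓ ∈ A.primeFactors.erase p, ((GaloisRep.cyclotomicCharacter ℚ p (σℓ ℓ) : ℤ_[p]ˣ) : ℤ_[p]) = ℓ) →
      ∀ (ιp : (m : ℕ) → (CyclotomicField m ℚ →+* ℂ_[p])),
        (∀ n : ℕ, ιp (cycLevel p (n + 1) ∅)
            (IsCyclotomicExtension.zeta (cycLevel p (n + 1) ∅) ℚ (CyclotomicField (cycLevel p (n + 1) ∅) ℚ)) ^ (p ^ n) =
          ιp (cycLevel p 1 ∅)
            (IsCyclotomicExtension.zeta (cycLevel p 1 ∅) ℚ (CyclotomicField (cycLevel p 1 ∅) ℚ))) →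
      ∃ (C' : ℂ_[p]) (w : (IwasawaAlgebra p)ˣ), ∀ n : ℕ, Even n →
        ∀ ψ : DirichletCharacter ℂ_[p] (p ^ (n + 1)), orderOf ψ = 2 * p ^ n →
        ∀ t : ℂ_[p],
          HasSum (fun k : ℕ ↦ ((algebraMap ℚ_[p] ℂ_[p]).comp (algebraMap ℤ_[p] ℚ_[p]))
              (PowerSeries.coeff k ((w : IwasawaAlgebra p) *
                katoMultiplier p c d₁ n₁ n₂ n₃ n₄
                  ((IwasawaCharacter.Psi p ℤ_[p] κ σc : (PowerSeries ℤ_[p])ˣ) : IwasawaAlgebra p)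
                  ((IwasawaCharacter.Psi p ℤ_[p] κ σd : (PowerSeries ℤ_[p])ˣ) : IwasawaAlgebra p)
                  (A.primeFactors.erase p) (fun ℓ => W.LFunction ℓ) (fun ℓ => if ℓ ∣ NW then 0 else 1)
                  (fun ℓ => ((IwasawaCharacter.Psi p ℤ_[p] κ (σℓ ℓ) : (PowerSeries ℤ_[p])ˣ) : IwasawaAlgebra p)))) *
              (ψ (cyclotomicGenerator p : ZMod (p ^ (n + 1))) - 1) ^ k) t →
          Kobayashi2003.padicGaussSum p (cycLevel p (n + 1) ∅) (ιp (cycLevel p (n + 1) ∅))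
              (DirichletCharacter.changeLevel (dvd_mul_right _ _ : p ^ (n + 1) ∣ cycLevel p (n + 1) ∅) ψ) *
            Kobayashi2003.padicCharSum p (cycLevel p (n + 1) ∅) (ιp (cycLevel p (n + 1) ∅))
              ((DirichletCharacter.changeLevel (dvd_mul_right _ _ : p ^ (n + 1) ∣ cycLevel p (n + 1) ∅) ψ) ^
                (p ^ n - 1))
              (Λ (n + 1) ∅ (resLe (tateRep W p).toTopRep
                (hκ.cyclotomicLevelsRat_level_succ_le_layerSubgroup hp ∅ n) 1
                (levelToLayer W p hκ hp (badPlaces c d₁ A NW) n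
                  (z (n + 1) (cyclotomicLevelsRat p (badPlaces c d₁ A NW)).idealOne)))) =
          C' * t * (if Even (p / 2) then ratTwistedSymbolSum f ψ else ratMinusTwistedSymbolSum f ψ)) :
    ∀ (p : ℕ) [Fact p.Prime], 5 ≤ p → ∀ (W : WeierstrassCurve ℚ) [W.IsElliptic] [W.IsGloballyMinimal],
      HasSignedLocalType W p (.Istar 0) → W.analyticRank = 1 →
      letI : ContinuousSMul ℤ_[p] (W.tateModule p) := TateModule.continuousSMul_padicInt
      ∀ (K₀ : Type) [Field K₀] [NumberField K₀] [IsCyclotomicExtension {p} ℚ K₀] [(galRange (K := ℚ) K₀).Normal]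
        (η : Field.absoluteGaloisGroup ℚ →* ℤˣ), (∀ σ ∈ galRange (K := ℚ) K₀, η σ = 1) → η ≠ 1 →
      ∀ (V : WeierstrassCurve ℚ) [V.IsElliptic] [V.IsGloballyMinimal] {N : ℕ} [NeZero N]
        {f : CuspForm (CongruenceSubgroup.Gamma0 N) 2},
        V.HasCM → V.HasGoodReductionAtPrime p → V.frobeniusTrace p = 0 → ModularForms.IsNewformOf V f →
      ∀ (ϖ : ℚ), (if Even (p / 2) then (ϖ : ℝ) * V.realPeriodRat = ModularForms.plusPeriod f
          else (ϖ : ℝ) * V.imaginaryPeriodRat = ModularForms.minusPeriod f) →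
      ∀ (κ : ZpExtension ℚ p) (hκ : κ.IsCyclotomic) (γ : Field.absoluteGaloisGroup ℚ) (_ : κ.IsTopGenerator γ),
        γ ∈ galRange (K := ℚ) K₀ → IsCyclotomicVariable p γ →
      ∀ (C : VariableChange ℚ), C • W.quadraticTwist ((-1) ^ (p / 2) * p) = V →
      ∀ (I : IwasawaH1Data W p κ γ),
        ∃ (FB₁ : W.FineSelmerDualData κ γ) (P₁ : Kobayashi2003.EtaColemanPoitouTateData p K₀ η V f ϖ κ γ W I FB₁)
          (z₁ : I.H) (a b : ℕ), Kato2004.IsAdmissibleZetaClass W p κ hκ I z₁ ∧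
            ((p : IwasawaAlgebra p) ^ a) • P₁.z = ((p : IwasawaAlgebra p) ^ b) • z₁ := by
  intro p _ hp5 W _ _ hT _ K₀ _ _ _ _ η hη hη1 V _ _ N _ f _ hgood hap hf ϖ hϖ κ hκ γ hγ hγK hvar C hCW I
  letI : ContinuousSMul ℤ_[p] (W.tateModule p) := TateModule.continuousSMul_padicInt
  have hP : p.Prime := Fact.out
  have hp2 : p ≠ 2 := by omega
  have hirr := StrictCount.hasIrreducibleModPGaloisRep_of_hasSignedLocalType_IstarZero W p hp5 hT
  obtain ⟨z₁, hz₁⟩ := hFCM W p κ γ hκ hγ hp2 hT.1 hT.2.1.1 hirr I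
  set FB₁ : W.FineSelmerDualData κ γ := W.fineSelmerDualData κ hγ with hFB₁
  obtain ⟨P₁, hP₁⟩ := hA p K₀ η hη hη1 V hp2 hgood hap hf ϖ hϖ κ γ hκ hγ hγK hvar W C hCW I FB₁
  letI : Module.Free ℤ_[p] (W.tateModule p) := W.module_free_tateModule_holds p
  letI : Module.Finite ℤ_[p] (W.tateModule p) := W.module_finite_tateModule_holds p
  have hz₁0 : z₁ ≠ 0 :=
    hz₁.ne_zero_of_rohrlich hγ fun hfW => PSRohrlichAtLevel.rohrlich_primePow_of_isNewformOf hfW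
  obtain ⟨hp2', NW, hNW, fW, hfW, ι, q, Λ, hq, ⟨d, hbody, -⟩, c, d₁, a, A, d', hA0, hc, hd, hdd', hR, z, x,
    hzeta, y, hy, qm, perRatio, e, u, n₁, n₂, n₃, n₄, σc, σd, σℓ, hqm, hspan, h₁, h₂, h₃, h₄, hσc, hσd, hσℓ,
    -, -, -, hpos⟩ := (isAdmissibleZetaClass_iff W p κ hκ I z₁).mp hz₁
  set M : IwasawaAlgebra p := katoMultiplier p c d₁ n₁ n₂ n₃ n₄
      ((IwasawaCharacter.Psi p ℤ_[p] κ σc : (PowerSeries ℤ_[p])ˣ) : IwasawaAlgebra p)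
      ((IwasawaCharacter.Psi p ℤ_[p] κ σd : (PowerSeries ℤ_[p])ˣ) : IwasawaAlgebra p)
      (A.primeFactors.erase p) (fun ℓ => W.LFunction ℓ) (fun ℓ => if ℓ ∣ NW then 0 else 1)
      (fun ℓ => ((IwasawaCharacter.Psi p ℤ_[p] κ (σℓ ℓ) : (PowerSeries ℤ_[p])ˣ) : IwasawaAlgebra p)) with hM
  have hM0 : M ≠ 0 := katoMultiplier_ne_zero (p := p) W hfW κ c d₁ a A d' hqm.ne' h₁ h₂ h₃ h₄ hR σc σd σℓ
  set Pp : IwasawaAlgebra p := (p : IwasawaAlgebra p) with hPp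
  haveI hNZ : NoZeroSMulDivisors (IwasawaAlgebra p) I.H := I.noZeroSMulDivisors hγ
  have hPp0 : Pp ≠ 0 := by
    have h := pow_mul_ne_zero_of_ne_zero p (one_ne_zero : (1 : IwasawaAlgebra p) ≠ 0) 1
    rwa [pow_one, mul_one] at h
  have hy0 : y ≠ 0 := fun hy0 => hz₁0
    ((IwasawaH1Data.eq_zero_iff_of_smul_eq_smul hγ I (pow_mul_ne_zero_of_ne_zero p hM0 _)
      (mul_ne_zero (Units.ne_zero u) (pow_ne_zero _ hPp0)) hpos).mpr hy0)
  have hg0 : P₁.colPlus y ≠ 0 := fun h0 => hy0 (P₁.colPlus_injective (by rw [h0, map_zero]))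
  obtain ⟨ιp, hCOH⟩ := exists_coherent_padicEmbeddings p
  obtain ⟨lam, -, hlaw⟩ := hP₁ fW d ι ((q : ℚ) : ℝ) Λ hbody ιp hCOH
  obtain ⟨C', w, hCval⟩ := hC p hp2 hp5 K₀ η hη hη1 V hgood hap hf W C hCW κ hκ fW hfW ι q Λ d hbody
    c d₁ a A d' hA0 hc hd hdd' hR z x hzeta qm n₁ n₂ n₃ n₄ σc σd σℓ hqm hspan h₁ h₂ h₃ h₄ hσc hσd hσℓ ιp hCOH
  obtain ⟨uK, huK⟩ := P₁.isPlus_colPlus_z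
  have hϖ0 : ϖ ≠ 0 := by
    rintro rfl
    have hQ := hf.coeffField_eq_bot_of_isNewformOf
    by_cases hδ : Even (p / 2)
    · rw [if_pos hδ] at hϖ
      have hpos' := IsNewform0.plusPeriod_pos_holds hf.1 hQ
      rw [← hϖ] at hpos'
      simp at hpos'
    · rw [if_neg hδ] at hϖ
      have hpos' := IsNewform0.minusPeriod_pos_holds hf.1 hQ
      rw [← hϖ] at hpos'
      simp at hpos'
  set Aκ : ℂ_[p] := algebraMap ℚ_[p] ℂ_[p] (((uK : ℤ_[p]) : ℚ_[p]) * (ϖ : ℚ_[p])) with hAκ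
  have hAκ0 : Aκ ≠ 0 := by
    rw [hAκ]
    refine (map_ne_zero _).mpr (mul_ne_zero ?_ (by exact_mod_cast hϖ0))
    exact fun h0 => Units.ne_zero uK (PadicInt.coe_eq_zero.mp h0)
  -- the element `h := w·M̃·Col⁺(P₁.z)` and the constant `Cst := λ C′ / (uK ϖ)`
  set hh : IwasawaAlgebra p := (w : IwasawaAlgebra p) * M * P₁.colPlus P₁.z with hhh
  set Cst : ℂ_[p] := lam * C' / Aκ with hCst
  set ιZ : ℤ_[p] →+* ℂ_[p] := (algebraMap ℚ_[p] ℂ_[p]).comp (algebraMap ℤ_[p] ℚ_[p]) with hιZ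
  have H : ∀ n : ℕ, Even n → 0 < n → ∀ ψ : DirichletCharacter ℂ_[p] (p ^ (n + 1)), orderOf ψ = 2 * p ^ n →
      ∀ a b : ℂ_[p],
        HasSum (fun k ↦ ιZ (PowerSeries.coeff k (P₁.colPlus y)) *
          (ψ (cyclotomicGenerator p : ZMod (p ^ (n + 1))) - 1) ^ k) a →
        HasSum (fun k ↦ ιZ (PowerSeries.coeff k hh) *
          (ψ (cyclotomicGenerator p : ZMod (p ^ (n + 1))) - 1) ^ k) b →
        a = Cst * b := by
    intro n hn _ ψ hψ a b ha hb
    have hz : ‖ψ (cyclotomicGenerator p : ZMod (p ^ (n + 1))) - 1‖ < 1 :=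
      norm_apply_cyclotomicGenerator_sub_one_lt' p hp2 ψ
    -- [A] at `y`, with (A4) `I.proj n y = levelToLayer … (z (n+1) 𝟙)`
    have hAy := hlaw y n hn ψ hψ
    rw [hy n] at hAy
    have hKz := huK n hn ψ hψ
    have hsumM : Summable fun k ↦ ιZ (PowerSeries.coeff k ((w : IwasawaAlgebra p) * M)) *
        (ψ (cyclotomicGenerator p : ZMod (p ^ (n + 1))) - 1) ^ k :=
      summable_map_coeff_mul_pow ιZ (norm_algebraMap_coeff_le_one _) hz
    set t : ℂ_[p] := ∑' k, ιZ (PowerSeries.coeff k ((w : IwasawaAlgebra p) * M)) *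
        (ψ (cyclotomicGenerator p : ZMod (p ^ (n + 1))) - 1) ^ k with ht
    have hCv := hCval n hn ψ hψ t hsumM.hasSum
    -- value of `hh = (w M) * Col⁺(P₁.z)` is `t * (value of Col⁺(P₁.z))`
    have hprod := tsum_map_coeff_mul_mul_pow ιZ (norm_algebraMap_coeff_le_one ((w : IwasawaAlgebra p) * M))
      (norm_algebraMap_coeff_le_one (P₁.colPlus P₁.z)) hz
    have hsumh : Summable fun k ↦ ιZ (PowerSeries.coeff k hh) *
        (ψ (cyclotomicGenerator p : ZMod (p ^ (n + 1))) - 1) ^ k :=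
      summable_map_coeff_mul_pow ιZ (norm_algebraMap_coeff_le_one _) hz
    have hb' : b = t * ((-1 : ℂ_[p]) ^ (n / 2 + 1) * Aκ *
        (if Even (p / 2) then ratTwistedSymbolSum f ψ else ratMinusTwistedSymbolSum f ψ) /
        (cyclotomicOmegaMinus p n).eval₂ (algebraMap ℤ ℂ_[p]) (ψ (cyclotomicGenerator p : ZMod (p ^ (n + 1))) - 1)) := by
      rw [hb.unique hsumh.hasSum, hhh, hprod, ← ht, hKz.tsum_eq]
    have ha' := ha.unique hAy
    rw [ha', hb', hCst]
    set E : ℂ_[p] := (-1 : ℂ_[p]) ^ (n / 2 + 1)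
    set ω : ℂ_[p] := (cyclotomicOmegaMinus p n).eval₂ (algebraMap ℤ ℂ_[p])
      (ψ (cyclotomicGenerator p : ZMod (p ^ (n + 1))) - 1)
    set S : ℂ_[p] := (if Even (p / 2) then ratTwistedSymbolSum f ψ else ratMinusTwistedSymbolSum f ψ)
    have key : ∀ τ' P' : ℂ_[p], τ' * P' = C' * t * S →
        lam * (E * τ' / ω) * P' = lam * C' / Aκ * (t * (E * Aκ * S / ω)) := by
      intro τ' P' hτP
      calc lam * (E * τ' / ω) * P' = lam * E * (τ' * P') * ω⁻¹ := by ring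
        _ = lam * E * (C' * t * S) * ω⁻¹ := by rw [hτP]
        _ = lam * C' / Aκ * (t * (E * Aκ * S / ω)) := by
          rw [div_eq_mul_inv, div_eq_mul_inv, ← mul_one (lam * E * (C' * t * S) * ω⁻¹),
            ← mul_inv_cancel₀ hAκ0]
          ring
    exact key _ _ hCv
  -- descent of the constant: `p^a · Col⁺(y) = (v·p^b) · hh` in `Λ`
  obtain ⟨-, -, -, a₁, b₁, v, hab⟩ := IwasawaAlgebra.exists_pow_smul_eq_of_values_proportional (p := p) hp2 hg0 Cst H
  have hab' : Pp ^ a₁ * P₁.colPlus y = (PowerSeries.C (v : ℤ_[p]) * Pp ^ b₁) * hh := by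
    have h := hab
    rw [PowerSeries.smul_eq_C_mul, PowerSeries.smul_eq_C_mul, map_pow, map_mul, map_pow, map_natCast] at h
    exact h
  -- (eq1) `p^a · y = (v p^b w M̃) · P₁.z` in `𝐇¹` by injectivity of `Col⁺`
  set vΛ : (IwasawaAlgebra p)ˣ := Units.map (PowerSeries.C : ℤ_[p] →+* IwasawaAlgebra p).toMonoidHom v with hvΛ
  have hvΛc : (vΛ : IwasawaAlgebra p) = PowerSeries.C (v : ℤ_[p]) := rfl
  have e1 : (Pp ^ a₁) • y = ((vΛ : IwasawaAlgebra p) * Pp ^ b₁ * ((w : IwasawaAlgebra p) * M)) • P₁.z := by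
    apply P₁.colPlus_injective
    rw [map_smul, map_smul, smul_eq_mul, smul_eq_mul, hab', hvΛc, hhh]
    ring
  -- (eq3) multiply the position by `p^a` and cancel `M̃`
  set U : (IwasawaAlgebra p)ˣ := u * vΛ * w with hU
  have e3 : M • ((Pp ^ (a₁ + (-e).toNat)) • z₁) = M • (((U : IwasawaAlgebra p) * Pp ^ (e.toNat + b₁)) • P₁.z) := by
    calc M • ((Pp ^ (a₁ + (-e).toNat)) • z₁)
        = (Pp ^ a₁) • ((Pp ^ (-e).toNat * M) • z₁) := by
          rw [smul_smul, smul_smul]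
          exact congrArg (fun r : IwasawaAlgebra p => r • z₁) (by ring)
      _ = (Pp ^ a₁) • (((u : IwasawaAlgebra p) * Pp ^ e.toNat) • y) := by rw [hpos]
      _ = ((u : IwasawaAlgebra p) * Pp ^ e.toNat) • ((Pp ^ a₁) • y) := by
          rw [smul_smul, smul_smul]
          exact congrArg (fun r : IwasawaAlgebra p => r • y) (mul_comm _ _)
      _ = ((u : IwasawaAlgebra p) * Pp ^ e.toNat) •
            (((vΛ : IwasawaAlgebra p) * Pp ^ b₁ * ((w : IwasawaAlgebra p) * M)) • P₁.z) := by rw [e1]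
      _ = M • (((U : IwasawaAlgebra p) * Pp ^ (e.toNat + b₁)) • P₁.z) := by
          rw [smul_smul, smul_smul, hU, Units.val_mul, Units.val_mul]
          exact congrArg (fun r : IwasawaAlgebra p => r • P₁.z) (by ring)
  have e4 : (Pp ^ (a₁ + (-e).toNat)) • z₁ = ((U : IwasawaAlgebra p) * Pp ^ (e.toNat + b₁)) • P₁.z :=
    smul_right_injective I.H hM0 e3
  refine ⟨FB₁, P₁, ((U⁻¹ : (IwasawaAlgebra p)ˣ) : IwasawaAlgebra p) • z₁, e.toNat + b₁, a₁ + (-e).toNat,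
    hz₁.units_smul U⁻¹, ?_⟩
  rw [smul_smul, mul_comm, ← smul_smul, e4, smul_smul, ← mul_assoc, Units.inv_mul, one_mul]

end Summit.BirchSwinnertonDyer.Rank1Residual.Additive.CccOneZetaLines

end
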